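import Summits.BirchSwinnertonDyer.Rank1Residual.Additive.QuadraticBranchPlusEtaNodes
import Summits.BirchSwinnertonDyer.Rank1Residual.Additive.QuadraticBranchPlusLFunctionUnique
import Summits.BirchSwinnertonDyer.Rank1Residual.X1.LambdaSqueezeAlgebra
import Literature.NumberTheory.EllipticCurves.BurungaleTian2026.EtaSignedMainConjectureTensorQ
import HarnessLib

/-!
# Route `QuadraticBranchSignedControl` (rung K8, cell `bsd-potss`), node (C1⁺_η) on the CM rows — item
# stmt-BirchSwinnertonDyer-19114 `PlusMainConjectureBranch` (CM twists) / residual crux 19606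
# `PlusEtaMainConjectureNonsurj` (stub `stub_etaMC_cm`): the `λ`-PART of Kobayashi's even main conjecture
# at `η` for a CM twist is a THEOREM from print — `λ(X⁺(V/K_∞)^η) = λ(L_p⁺(V, η, X))` in the kernel,
# from Burungale–Tian 2026 Thm. 2.6 (seat `bsd-potss-k8q-c2` g3)

WHAT. Companion of `…PlusEtaCMRowsUpToMu` (p478350: on the CM rows (C1⁺_η) ⟺ the `μ`-equality) and
`…PlusEtaCMRankZeroOfBT26` (p478801: CM rank-`0` rows in full from named facts). The named fact
`BurungaleTian2026.thm26_etaKatoSequences_charIdeal_upToP_of_cm` (Burungale–Tian, Ann. of Math. 203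
(2026) Thm. 2.6 ∘ Kobayashi 2003 §5 / 7.1 ii) / proof of 7.4) gives, for a CM `V` good at the odd `p`
with `a_p = 0` and every `η`-datum `D`, `(p^b)·Char(D.X) = (p^a)·(Lη)`. This file records the
consequence that does NOT depend on the open `μ`-part: the two characteristic power series have the
same `λ`-INVARIANT (same Weierstrass degree of the `p`-free part): with the cell's power-series
invariant `X1.MuLambda.lam` and the tree theorem `lam (generator of Char M) = lambdaInvariant M`
(`X1.ParitySqueeze.lam_generator_eq_lambdaInvariant`), **`lambdaInvariant p D.X = lam Lη`** for every
`η`-datum `D` of a CM twist and every `Lη` with the interpolation property of `L_p⁺(V, η, X)` — the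
`λ`-half of item 19606's CM stub, from the two named facts `h26`, `h22` alone. (Kobayashi's Thm. 1.4-type
asymptotics for `ord_p #Ш` up the tower at `η` are governed by `λ` and `μ`; after this file only `μ` of
`X⁺(V/K_∞)^η` is not tied to print on the CM rows.)
* §1 `lam_eq_of_upToP` — `(p^b)·(g) = (p^a)·(L)` with `g, L ≠ 0` forces `lam g = lam L`.
* §2 `lambdaInvariant_eq_lam_of_cm` (per datum), `lambdaInvariant_eq_lam_on_cmRows_of_bt26` (∀-form on
  19606's CM binders).

HONEST FRAMING (cell `bsd-potss`, run/shared/lean/pub/bsd-potss/; FULL-BSD rank ≤ 1 programme, tranche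
1b, HUMAN RULING D-0036/D-0074): THEOREMS ONLY — no definition, no new named fact, no Summits-side
`def … : Prop`, no `sorry`, axioms standard. CONDITIONAL on the named facts `h26` (BT26 Thm. 2.6 ∘ Kob03;
NOT proved in the tree) and `h22` (Kobayashi Thm. 2.2 at `η`). Item 19114, crux 19606 and `stub_etaMC_cm`
stay OPEN (the `μ`-part); nothing is booked; no label / mark / count of `RESIDUAL-MAP.md` moves; BSD is not
proved for any curve by this. `--supports stmt-BirchSwinnertonDyer-19606`.

References: [BurungaleTian2026] Thm. 2.6 and Rem. 2.7 (p. 5); [Kobayashi2003] §4 Even main conjecture and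
Thm. 1.4 (pp. 3, 8), Thm. 2.2 (p. 5), proof of Thm. 7.4 (p. 13); [Washington1997] §7.1, §13.2.
-/

set_option autoImplicit false
set_option linter.dupNamespace false

noncomputable section

open scoped Classical

open CongruenceSubgroup WeierstrassCurve Field Literature.NumberTheory.EllipticCurves
  Literature.NumberTheory.EllipticCurves.ModularForms Literature.NumberTheory.GaloisRepresentations
  ZpExtension
open Literature.NumberTheory.EllipticCurves.IwasawaAlgebra
open Summit.BirchSwinnertonDyer.Rank1Residual.X1.MuLambda
open Summit.BirchSwinnertonDyer.Rank1Residual.X1.ParitySqueeze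
open Summit.BirchSwinnertonDyer.Rank1Residual.Additive

namespace Summit.BirchSwinnertonDyer.BirchSwinnertonDyer.Theorems

namespace EtaCMLambdaBT26

/-! ## §1 `λ` along `(p^b)·(g) = (p^a)·(L)` -/

section Algebra

variable {p : ℕ} [hp : Fact p.Prime]

/-- `p^k = C(p^k)` in `Λ = ℤ_p⟦X⟧` and it is non-zero. [folklore] -/
private theorem natCast_pow_eq_C (k : ℕ) :
    ((p : IwasawaAlgebra p) ^ k) = PowerSeries.C ((p : ℤ_[p]) ^ k) := by
  rw [map_pow, map_natCast]

/-- **`λ` is blind to powers of `p` and to units**: if `(p^b)·(g) = (p^a)·(L)` as ideals of `Λ` with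
`g, L ≠ 0`, then `lam g = lam L` (`p^b·g·u = p^a·L` for a unit `u`; `λ` is additive, vanishes on units
and on `p^k`). [cite: Washington1997, §7.1, §13.2] -/
theorem lam_eq_of_upToP {g L : IwasawaAlgebra p} {a b : ℕ}
    (hab : Ideal.span {(p : IwasawaAlgebra p) ^ b} * Ideal.span {g} =
      Ideal.span {(p : IwasawaAlgebra p) ^ a} * Ideal.span {L})
    (hg : g ≠ 0) (hL : L ≠ 0) : lam g = lam L := by
  rw [Ideal.span_singleton_mul_span_singleton, Ideal.span_singleton_mul_span_singleton,
    Ideal.span_singleton_eq_span_singleton] at hab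
  obtain ⟨u, hu⟩ := hab
  have hpb : ((p : IwasawaAlgebra p) ^ b) ≠ 0 := by
    rw [natCast_pow_eq_C]; exact C_pow_ne_zero b
  have h1 : lam ((p : IwasawaAlgebra p) ^ b * g * (u : IwasawaAlgebra p)) = lam g := by
    rw [lam_mul (mul_ne_zero hpb hg) u.ne_zero, lam_eq_zero_of_isUnit u.isUnit, add_zero,
      natCast_pow_eq_C, lam_C_pow_mul b hg]
  have h2 : lam ((p : IwasawaAlgebra p) ^ a * L) = lam L := by
    rw [natCast_pow_eq_C, lam_C_pow_mul a hL]
  rw [← h1, hu, h2]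

/-- A characteristic ideal equal to `(p^a)·(L)` up to `(p^b)` forces `L ≠ 0`. [cite: Washington1997, §13.2] -/
private theorem ne_zero_of_upToP (X : Type) [AddCommGroup X] [Module (IwasawaAlgebra p) X]
    {L : IwasawaAlgebra p} {a b : ℕ}
    (hab : Ideal.span {(p : IwasawaAlgebra p) ^ b} * Module.charIdeal (IwasawaAlgebra p) X =
      Ideal.span {(p : IwasawaAlgebra p) ^ a} * Ideal.span {L}) : L ≠ 0 := by
  intro hL
  obtain ⟨g, hg0, hg⟩ := BurungaleTian2026.exists_charIdeal_eq_span_ne_zero (p := p) X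
  have hpb : ((p : IwasawaAlgebra p) ^ b) ≠ 0 := by
    rw [natCast_pow_eq_C]; exact C_pow_ne_zero b
  have h1 : Ideal.span {(p : IwasawaAlgebra p) ^ b * g} = ⊥ := by
    rw [← Ideal.span_singleton_mul_span_singleton, ← hg, hab, hL, Ideal.span_singleton_mul_span_singleton,
      mul_zero, Ideal.span_singleton_eq_bot]
  exact mul_ne_zero hpb hg0 (Ideal.span_singleton_eq_bot.mp h1)

end Algebra

/-! ## §2 The `λ`-part of (C1⁺_η) on the CM rows -/

section PerPair

variable {p : ℕ} [hp : Fact p.Prime] {V : WeierstrassCurve ℚ} [V.IsElliptic] [V.IsGloballyMinimal]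

/-- **`λ(X⁺(V/K_∞)^η) = λ(L_p⁺(V, η, X))` for a CM twist** (kernel). For `V/ℚ` CM, globally minimal,
good at the odd `p` with `a_p(V) = 0`, on the binders of the node `QuadraticBranchPlusEtaMainConjectureAt V p`
(abstract `K₀ = ℚ(μ_p)`, the quadratic `ηq`, newform `f`, period ratio `ϖ`, ANY `Lη` with the
interpolation property, cyclotomic `κ`, generator `γ`) and for EVERY `η`-datum `D`: the `λ`-invariant of
the `Λ`-module `D.X` (tree `lambdaInvariant`) equals the `λ`-invariant of the power series `Lη` (cell
`X1.MuLambda.lam`: the order of the reduction mod `p` of the `p`-free part). From Burungale–Tian's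
`(p^b)·Char(D.X) = (p^a)·(Lη)` (named fact `h26` through the `rfl` bridge `D.toLiterature`, `huniq`
discharged by `IsQuadraticBranchPlusLFunction.span_singleton_eq`), Kobayashi's Thm. 2.2 at `η` (`h22`:
`D.X` finitely generated torsion) and `lam (generator) = lambdaInvariant`. CONDITIONAL on the two named
facts; the `μ`-part stays open; nothing booked.
[cite: BurungaleTian2026, Thm. 2.6 (p. 5)] [cite: Kobayashi2003, §4 (p. 8), Thm. 2.2 (p. 5)] [cite: Washington1997, §13.2] -/
theorem lambdaInvariant_eq_lam_of_cm
    (h26 : BurungaleTian2026.thm26_etaKatoSequences_charIdeal_upToP_of_cm)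
    (h22 : Kobayashi2003.thm22_etaSignedSelmerDual_finite_torsion) (hCM : V.HasCM)
    {K₀ : Type} [Field K₀] [NumberField K₀] [IsCyclotomicExtension {p} ℚ K₀]
    [(galRange (K := ℚ) K₀).Normal] {ηq : absoluteGaloisGroup ℚ →* ℤˣ}
    (hηK : ∀ σ ∈ galRange (K := ℚ) K₀, ηq σ = 1) (hη1 : ηq ≠ 1)
    {N : ℕ} [NeZero N] {f : CuspForm (Gamma0 N) 2}
    (hp2 : p ≠ 2) (hgood : V.HasGoodReductionAtPrime p) (hap : V.frobeniusTrace p = 0)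
    (hf : IsNewformOf V f) (ϖ : ℚ)
    (hϖ : if Even (p / 2) then (ϖ : ℝ) * V.realPeriodRat = plusPeriod f
      else (ϖ : ℝ) * V.imaginaryPeriodRat = minusPeriod f)
    (Lη : IwasawaAlgebra p) (hL : IsQuadraticBranchPlusLFunction f p ϖ Lη)
    {κ : ZpExtension ℚ p} {γ : absoluteGaloisGroup ℚ} (hκ : κ.IsCyclotomic)
    (hγ : κ.IsTopGenerator γ) (hγK : γ ∈ galRange (K := ℚ) K₀) (hγc : IsCyclotomicVariable p γ)
    (D : EtaSignedSelmerDualData V κ K₀ ℚ_[p] ηq γ 1) :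
    lambdaInvariant p D.X = lam Lη := by
  obtain ⟨hfin, htor⟩ :=
    EtaSignedSelmerDualData.finite_isTorsion_of_thm22 h22 hηK hp2 hgood hap hκ hγ hγK D
  haveI := hfin
  obtain ⟨a, b, hab⟩ := BurungaleTian2026.evenEtaCharIdeal_eq_upToP_of_cm_of_unique h26 h22 K₀ ηq hηK
    hη1 V hp2 hCM hgood hap hf ϖ hϖ
    (fun _ _ h₁ h₂ => IsQuadraticBranchPlusLFunction.span_singleton_eq (f := f) hp2 h₁ h₂)
    κ γ hκ hγ hγK hγc Lη hL D.toLiterature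
  have hab2 : Ideal.span {(p : IwasawaAlgebra p) ^ b} * Module.charIdeal (IwasawaAlgebra p) D.X =
      Ideal.span {(p : IwasawaAlgebra p) ^ a} * Ideal.span {Lη} := hab
  obtain ⟨g, hg0, hg⟩ := BurungaleTian2026.exists_charIdeal_eq_span_ne_zero (p := p) D.X
  have hL0 : Lη ≠ 0 := ne_zero_of_upToP D.X hab2
  have habg : Ideal.span {(p : IwasawaAlgebra p) ^ b} * Ideal.span {g} =
      Ideal.span {(p : IwasawaAlgebra p) ^ a} * Ideal.span {Lη} := by
    rw [← hg]; exact hab2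
  rw [← lam_generator_eq_lambdaInvariant D.X htor hg0 hg]
  exact lam_eq_of_upToP habg hg0 hL0

end PerPair

/-- **The `λ`-part of 19606's CM stub, ∀-form on its binders**: granted `h26` (BT26 Thm. 2.6 ∘ Kob03)
and `h22` (Kob03 Thm. 2.2 at `η`), for every `p ≥ 5` and every good `a_p = 0` CM twist `V` (the `¬ onto`
binder idle), on the node's binders and for every `η`-datum: `λ(X⁺(V/K_∞)^η) = λ(L_p⁺(V, η, X))`.
CONDITIONAL; closes nothing (the stub's `μ`-part remains); nothing booked.
[cite: BurungaleTian2026, Thm. 2.6 and Rem. 2.7 (p. 5)] [cite: Kobayashi2003, §4 (p. 8), Thm. 1.4 (p. 3)] -/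
theorem lambdaInvariant_eq_lam_on_cmRows_of_bt26
    (h26 : BurungaleTian2026.thm26_etaKatoSequences_charIdeal_upToP_of_cm)
    (h22 : Kobayashi2003.thm22_etaSignedSelmerDual_finite_torsion) :
    ∀ (V : WeierstrassCurve ℚ) [V.IsElliptic] [V.IsGloballyMinimal] (p : ℕ) [Fact p.Prime],
      5 ≤ p → V.HasGoodReductionAtPrime p → V.frobeniusTrace p = 0 →
      ¬ (∀ m : ℕ, V.HasSurjectiveModNGaloisRep (p ^ m : ℕ)) → V.HasCM →
      ∀ (K₀ : Type) [Field K₀] [NumberField K₀] [IsCyclotomicExtension {p} ℚ K₀]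
          [(galRange (K := ℚ) K₀).Normal] (ηq : absoluteGaloisGroup ℚ →* ℤˣ),
          (∀ σ ∈ galRange (K := ℚ) K₀, ηq σ = 1) → ηq ≠ 1 →
        ∀ {N : ℕ} [NeZero N] {f : CuspForm (Gamma0 N) 2},
          p ≠ 2 → V.HasGoodReductionAtPrime p → V.frobeniusTrace p = 0 → IsNewformOf V f →
        ∀ (ϖ : ℚ), (if Even (p / 2) then (ϖ : ℝ) * V.realPeriodRat = plusPeriod f
            else (ϖ : ℝ) * V.imaginaryPeriodRat = minusPeriod f) →
        ∀ (Lη : IwasawaAlgebra p), IsQuadraticBranchPlusLFunction f p ϖ Lη →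
        ∀ (κ : ZpExtension ℚ p) (γ : absoluteGaloisGroup ℚ),
          κ.IsCyclotomic → κ.IsTopGenerator γ → γ ∈ galRange (K := ℚ) K₀ → IsCyclotomicVariable p γ →
        ∀ (D : EtaSignedSelmerDualData V κ K₀ ℚ_[p] ηq γ 1), lambdaInvariant p D.X = lam Lη := by
  intro V _ _ p _ _ _ _ _ hCM K₀ _ _ _ _ ηq hηK hη1 N _ f hp2 hgood hap hf ϖ hϖ Lη hL κ γ hκ hγ hγK hγc D
  exact lambdaInvariant_eq_lam_of_cm h26 h22 hCM hηK hη1 hp2 hgood hap hf ϖ hϖ Lη hL hκ hγ hγK hγc D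

end EtaCMLambdaBT26

end Summit.BirchSwinnertonDyer.BirchSwinnertonDyer.Theorems

end
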